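import Literature.AlgebraicGeometry.HodgeTheory.HypersurfaceCutOutByLefschetz
import Literature.AlgebraicGeometry.HodgeTheory.BettiUniverseIsoTransport
import Literature.AlgebraicGeometry.HodgeTheory.IsoTransport
import Literature.AlgebraicGeometry.HodgeTheory.HodgeConjecture
import Literature.AlgebraicGeometry.Motives.FermatHypersurface
import Literature.AlgebraicGeometry.Motives.VarietiesProjectiveSpaceProofs
import Literature.AlgebraicGeometry.Motives.VarietiesGeometricallyIntegralProofs
import Literature.AlgebraicGeometry.Motives.ComplexPointsManifold
import HarnessLib

/-!
# A smooth `n`-fold cut out by one form is cut out by a NON-ZERO form; the Hodge conjecture for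
# odd-dimensional varieties cut out by one form; limits of one-legged fans (all proved)

Family `hodge`, layer `Literature/AlgebraicGeometry/HodgeTheory`. Written by the cross-ladder
literature-typing seat `littype-FH1-2` (cell `hodge-nonav`) for the route
`HodgeConjecture/SignSymmetricPowers`, cruxes K1 (`VeryGeneralSignCommutatorsInHg`, p3 line
`andre-zariski`: stubs `SignDeckModel`, `ModelTransfer`) and K2 (`PowersHodgeOfSignCommutators`, birth
stubs `stub_square` / `stub_higherPowers`), whose statements quantify over ALL homogeneous ι-even forms
`f` of degree `d` with `IsSmoothProjective 3 X ∧ IsHypersurfaceCutOutBy 4 f X` (resp.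
`IsSmoothProjective 3 (SmoothHypersurface.hypersurface f)`) — INCLUDING `f = 0`, where `V₊(0) = ℙ⁴`.
This file closes that corner and the `k = 0` rung of K2:

* §1 **`ℙᴺ` is cut out by the zero form** (`isHypersurfaceCutOutBy_zero_projectiveSpace`), hence every
  reduced `X` cut out by `0` in `ℙⁿ⁺¹` is isomorphic to `ℙⁿ⁺¹` (`nonempty_iso_projectiveSpace_of_zero`,
  the tree's `IsHypersurfaceCutOutBy.nonempty_iso`, Hartshorne II Ex. 3.11 (d)).
* §2 **A smooth projective `n`-fold is never cut out by `0` in `ℙⁿ⁺¹`**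
  (`not_isSmoothProjective_of_isHypersurfaceCutOutBy_zero`): `H²ⁿ⁺²(ℙⁿ⁺¹(ℂ); ℚ) ≅ ℚ` (top class of the
  smooth projective `(n+1)`-fold `ℙⁿ⁺¹`, Hatcher Thm. 3.26) while `H²ⁿ⁺²(X(ℂ); ℚ) = 0` for an `n`-fold
  (Hatcher Thm. 3.26 (c)); consumer forms `IsSmoothProjective.ne_zero_of_isHypersurfaceCutOutBy`
  (`f ≠ 0`) and `ne_zero_of_isSmoothProjective_hypersurface` (the model `X_f`).
* §3 the `f ≠ 0`-free forms of the Lefschetz consequences of `HypersurfaceCutOutByLefschetz`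
  (`algebraicClasses_eq_top_of_isHypersurfaceCutOutBy'`, `…_threefold'`,
  `subsingleton_bettiCohomology_one_and_five_threefold'`, `exists_isSmoothHypersurface'`).
* §4 **The Hodge conjecture holds for every smooth projective variety of ODD dimension cut out by one
  form** (`hodgeConjectureFor_of_isHypersurfaceCutOutBy_of_odd`; Voisin II Cor. 1.24/1.25: all of
  `H^{2p}` is algebraic since `2p ≠ n`) — the case `k = 0` (`Y = X`) of crux K2, free of K1.
* §5 **Limits of one-legged fans are isomorphic to the vertex** (`isIso_of_isLimit_fan_of_unique`,
  `nonempty_iso_of_isLimit_fan_fin_one`) and the Hodge conjecture passes to them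
  (`hodgeConjectureFor_of_isLimit_fan_fin_one`): the K2 hypothesis
  `∃ π : Fin (k+1) → (Y ⟶ X), Nonempty (IsLimit (Fan.mk Y π))` at `k = 0`.

No definition, no named fact (D-0026).

## References

* [Hartshorne1977] R. Hartshorne, Algebraic Geometry, GTM 52 (1977), II Ex. 3.11 (d), II Ex. 5.10.
* [HatcherAT2002] A. Hatcher, Algebraic Topology (2002), §3.3 Thm. 3.26.
* [VoisinHodgeII2003] C. Voisin, Hodge Theory and Complex Algebraic Geometry II (2003), §1.2.3
  Cor. 1.24, Cor. 1.25.
* [MacLane1998] (categorical folklore: a product over a one-object index is the object) — cited via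
  [KashiwaraSchapira2006] M. Kashiwara, P. Schapira, Categories and Sheaves (2006), §2.1–§2.2.
-/

noncomputable section

open CategoryTheory CategoryTheory.Limits AlgebraicGeometry Module
open Literature.AlgebraicTopology.SingularHomology
open Literature.AlgebraicGeometry.Motives

namespace Literature.AlgebraicGeometry.HodgeTheory

universe u

section CutOutByZero

/-! ### §1 `ℙᴺ` is cut out by the zero form -/

/-- **`ℙᴺ_k` is cut out in `ℙᴺ_k` by the zero form**: it is reduced (integral, being smooth projective —
the tree's `isSmoothProjective_projectiveSpace_holds`, `IsSmoothProjective.isIntegral_holds`), the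
identity is a closed immersion, and `V₊(0) = ℙᴺ`. [cite: Hartshorne1977, II Ex. 3.11 (d) and II Example 3.2.6] -/
theorem isHypersurfaceCutOutBy_zero_projectiveSpace (k : Type u) [Field k] (N : ℕ) :
    IsHypersurfaceCutOutBy N (0 : MvPolynomial (Fin (N + 1)) k) (projectiveSpace N k) := by
  haveI : IsIntegral (projectiveSpace N k).left :=
    IsSmoothProjective.isIntegral_holds (isSmoothProjective_projectiveSpace_holds k N)
  refine ⟨inferInstance, 𝟙 _, ?_, ?_⟩
  · change IsClosedImmersion (𝟙 (projectiveSpace N k).left)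
    infer_instance
  · letI := MvPolynomial.gradedAlgebra (σ := Fin (N + 1)) (R := k)
    rw [ProjectiveSpectrum.zeroLocus_singleton_zero]
    change Set.range (𝟙 (projectiveSpace N k).left : (projectiveSpace N k).left ⟶ _).base = Set.univ
    simp

/-- **A reduced `k`-scheme cut out by `0` in `ℙᴺ` is `ℙᴺ`** (`k`-isomorphic to it): two reduced closed
subschemes with the same support are isomorphic over the ambient space (the tree's
`IsHypersurfaceCutOutBy.nonempty_iso`). [cite: Hartshorne1977, II Ex. 3.11 (d)] -/
theorem nonempty_iso_projectiveSpace_of_zero {k : Type u} [Field k] {N : ℕ} {X : SchemeOver k}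
    (h : IsHypersurfaceCutOutBy N (0 : MvPolynomial (Fin (N + 1)) k) X) :
    Nonempty (X ≅ projectiveSpace N k) :=
  h.nonempty_iso (isHypersurfaceCutOutBy_zero_projectiveSpace k N)

/-! ### §2 A smooth projective `n`-fold is not cut out by `0` in `ℙⁿ⁺¹` -/

variable {n : ℕ} {X : SchemeOver ℂ}

/-- **No smooth projective `n`-fold over `ℂ` is cut out by the zero form in `ℙⁿ⁺¹`.** Such an `X`
would be isomorphic to `ℙⁿ⁺¹` (§1); but `H²ⁿ⁺²(ℙⁿ⁺¹(ℂ); ℚ) ≅ ℚ` (`ℙⁿ⁺¹` is a smooth projective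
`(n+1)`-fold, top cohomology of a closed connected oriented manifold, the tree's
`BettiUniverse.finrank_bettiCohomology_top`), whereas `H²ⁿ⁺²(X(ℂ); ℚ) = 0` for the closed
`2n`-manifold `X(ℂ)` (`subsingleton_singularCohomology_of_lt`).
[cite: HatcherAT2002, §3.3 Thm. 3.26] [cite: Hartshorne1977, II Ex. 3.11 (d)] -/
theorem not_isSmoothProjective_of_isHypersurfaceCutOutBy_zero
    (h : IsHypersurfaceCutOutBy (n + 1) (0 : MvPolynomial (Fin (n + 2)) ℂ) X) :
    ¬ IsSmoothProjective n X := by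
  intro hX
  obtain ⟨e⟩ := nonempty_iso_projectiveSpace_of_zero h
  have hP : IsSmoothProjective (n + 1) (projectiveSpace (n + 1) ℂ) :=
    isSmoothProjective_projectiveSpace_holds ℂ (n + 1)
  have h1 : finrank ℚ (bettiCohomology (projectiveSpace (n + 1) ℂ) (2 * (n + 1))) = 1 :=
    BettiUniverse.finrank_bettiCohomology_top hP
  haveI : Subsingleton (bettiCohomology X (2 * (n + 1))) :=
    ComplexPoints.subsingleton_singularCohomology_of_lt hX ℚ (by omega)
  haveI : Subsingleton (bettiCohomology (projectiveSpace (n + 1) ℂ) (2 * (n + 1))) :=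
    (BettiUniverse.pullEquiv e (2 * (n + 1))).symm.toEquiv.subsingleton
  have h0 : finrank ℚ (bettiCohomology (projectiveSpace (n + 1) ℂ) (2 * (n + 1))) = 0 :=
    finrank_zero_of_subsingleton
  omega

/-- **Consumer form: a form cutting out a smooth projective `n`-fold in `ℙⁿ⁺¹` is non-zero.** In the
route statements `∀ f, f.IsHomogeneous d → … → IsHypersurfaceCutOutBy 4 f X → …` with
`IsSmoothProjective 3 X` the case `f = 0` is thereby vacuous. [cite: HatcherAT2002, §3.3 Thm. 3.26] -/
theorem _root_.Literature.AlgebraicGeometry.Motives.IsSmoothProjective.ne_zero_of_isHypersurfaceCutOutBy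
    (hX : IsSmoothProjective n X) {f : MvPolynomial (Fin (n + 2)) ℂ}
    (h : IsHypersurfaceCutOutBy (n + 1) f X) : f ≠ 0 := by
  rintro rfl
  exact not_isSmoothProjective_of_isHypersurfaceCutOutBy_zero h hX

/-- **Model form: if `X_f = V₊(f) ⊂ ℙⁿ⁺¹_ℂ` (the tree's `SmoothHypersurface.hypersurface f`) is a smooth
projective `n`-fold then `f ≠ 0`** — the case `f = 0` of the p3 stub `SignDeckModel`
(`∀ f …, ∀ hXF : IsSmoothProjective 3 (hypersurface f), …`) is vacuous. [cite: HatcherAT2002, §3.3 Thm. 3.26] -/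
theorem ne_zero_of_isSmoothProjective_hypersurface {f : MvPolynomial (Fin (n + 2)) ℂ}
    (hXF : IsSmoothProjective n (SmoothHypersurface.hypersurface f)) : f ≠ 0 :=
  hXF.ne_zero_of_isHypersurfaceCutOutBy (SmoothHypersurface.isHypersurfaceCutOutBy_self f)

/-- The same as a negative statement about the model of the zero form. [cite: HatcherAT2002, §3.3 Thm. 3.26] -/
theorem not_isSmoothProjective_hypersurface_zero (n : ℕ) :
    ¬ IsSmoothProjective n (SmoothHypersurface.hypersurface (0 : MvPolynomial (Fin (n + 2)) ℂ)) :=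
  fun h ↦ ne_zero_of_isSmoothProjective_hypersurface h rfl

/-! ### §3 The Lefschetz consequences without the hypothesis `f ≠ 0` -/

variable {f : MvPolynomial (Fin (n + 2)) ℂ} {d : ℕ}

/-- A smooth projective `n`-fold cut out by a form is a smooth hypersurface (of the degree of an
irreducible factor) — `exists_isSmoothHypersurface` with `f ≠ 0` discharged by §2.
[cite: Hartshorne1977, I Ex. 1.8 and II Ex. 5.10] -/
theorem _root_.Literature.AlgebraicGeometry.Motives.IsSmoothProjective.exists_isSmoothHypersurface'
    (hX : IsSmoothProjective n X) (hf : f.IsHomogeneous d) (h : IsHypersurfaceCutOutBy (n + 1) f X) :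
    ∃ d', 1 ≤ d' ∧ IsSmoothHypersurface n d' X :=
  hX.exists_isSmoothHypersurface hf (hX.ne_zero_of_isHypersurfaceCutOutBy h) h

/-- **Off the middle degree every class of a smooth `n`-fold cut out by one form is algebraic**,
`algebraicClasses X p = ⊤` for `2p ≠ n` — `algebraicClasses_eq_top_of_isHypersurfaceCutOutBy` with
`f ≠ 0` discharged by §2. [cite: VoisinHodgeII2003, §1.2.3 Cor. 1.24 and Cor. 1.25] -/
theorem algebraicClasses_eq_top_of_isHypersurfaceCutOutBy' (hX : IsSmoothProjective n X)
    (hf : f.IsHomogeneous d) (h : IsHypersurfaceCutOutBy (n + 1) f X) {p : ℕ} (hp : 2 * p ≠ n) :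
    algebraicClasses X p = ⊤ :=
  algebraicClasses_eq_top_of_isHypersurfaceCutOutBy hX hf (hX.ne_zero_of_isHypersurfaceCutOutBy h) h hp

/-- Threefold form: `algebraicClasses X p = ⊤` for every `p`, for a smooth projective threefold cut out
by a form in `ℙ⁴` (no `f ≠ 0` hypothesis). [cite: VoisinHodgeII2003, §1.2.3 Cor. 1.24 and Cor. 1.25] -/
theorem algebraicClasses_eq_top_threefold' {X : SchemeOver ℂ} {f : MvPolynomial (Fin 5) ℂ} {d : ℕ}
    (hX : IsSmoothProjective 3 X) (hf : f.IsHomogeneous d) (h : IsHypersurfaceCutOutBy 4 f X) (p : ℕ) :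
    algebraicClasses X p = ⊤ :=
  algebraicClasses_eq_top_threefold hX hf (hX.ne_zero_of_isHypersurfaceCutOutBy h) h p

/-- Threefold form: `H¹(X(ℂ); ℚ) = 0 = H⁵(X(ℂ); ℚ)` for a smooth projective threefold cut out by a form
in `ℙ⁴` (no `f ≠ 0` hypothesis). [cite: VoisinHodgeII2003, §1.2.2 Thm. 1.23] -/
theorem subsingleton_bettiCohomology_one_and_five_threefold' {X : SchemeOver ℂ}
    {f : MvPolynomial (Fin 5) ℂ} {d : ℕ} (hX : IsSmoothProjective 3 X) (hf : f.IsHomogeneous d)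
    (h : IsHypersurfaceCutOutBy 4 f X) :
    Subsingleton (bettiCohomology X 1) ∧ Subsingleton (bettiCohomology X 5) :=
  subsingleton_bettiCohomology_one_and_five_threefold hX hf (hX.ne_zero_of_isHypersurfaceCutOutBy h) h

end CutOutByZero

section HodgeConjecture

variable {n : ℕ} {X : SchemeOver ℂ} {f : MvPolynomial (Fin (n + 2)) ℂ} {d : ℕ}

/-! ### §4 The Hodge conjecture for odd-dimensional varieties cut out by one form -/

/-- **If every `algebraicClasses X p` is all of `H²ᵖ`, the Hodge conjecture holds for `X`** (given a
Hodge model, here from the tree's `exists_isReal_hodgeModel`, hypothesis `hHD`, PROVED as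
`exists_isReal_hodgeModel_holds`). [cite: VoisinHodgeII2003, §1.2.3 Cor. 1.25] -/
theorem hodgeConjectureFor_of_forall_algebraicClasses_eq_top (hHD : exists_isReal_hodgeModel)
    (hX : IsSmoothProjective n X) (h : ∀ p : ℕ, algebraicClasses X p = ⊤) :
    HodgeConjectureFor n X := by
  obtain ⟨A, -⟩ := hHD n X hX
  refine ⟨⟨A⟩, fun p c _ _ ↦ ?_⟩
  rw [h p]
  trivial

/-- **The Hodge conjecture holds for every smooth projective variety of odd dimension `n` cut out by
one form in `ℙⁿ⁺¹_ℂ`**: for `2p ≠ n` (automatic, `n` odd) all of `H²ᵖ(X(ℂ); ℂ)` consists of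
algebraic classes (Lefschetz hyperplane theorem + hard Lefschetz, Voisin II Cor. 1.24/1.25, the
tree's `algebraicClasses_eq_top_of_isHypersurfaceCutOutBy`; `f ≠ 0` by §2). This is the rung `k = 0`
(`Y = X`) of crux K2 `PowersHodgeOfSignCommutators`, which needs no input from K1.
[cite: VoisinHodgeII2003, §1.2.3 Cor. 1.24 and Cor. 1.25] -/
theorem hodgeConjectureFor_of_isHypersurfaceCutOutBy_of_odd (hHD : exists_isReal_hodgeModel)
    (hX : IsSmoothProjective n X) (hn : Odd n) (hf : f.IsHomogeneous d)
    (h : IsHypersurfaceCutOutBy (n + 1) f X) : HodgeConjectureFor n X :=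
  hodgeConjectureFor_of_forall_algebraicClasses_eq_top hHD hX fun p ↦
    algebraicClasses_eq_top_of_isHypersurfaceCutOutBy' hX hf h fun h2 ↦
      (Nat.not_even_iff_odd.mpr hn) ⟨p, by omega⟩

/-- Threefold form (the route's `n = 3`, `ℙ⁴`, quinary forms): the Hodge conjecture for a smooth
projective threefold cut out by a form. [cite: VoisinHodgeII2003, §1.2.3 Cor. 1.24 and Cor. 1.25] -/
theorem hodgeConjectureFor_threefold_of_isHypersurfaceCutOutBy (hHD : exists_isReal_hodgeModel)
    {X : SchemeOver ℂ} {f : MvPolynomial (Fin 5) ℂ} {d : ℕ} (hX : IsSmoothProjective 3 X)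
    (hf : f.IsHomogeneous d) (h : IsHypersurfaceCutOutBy 4 f X) : HodgeConjectureFor 3 X :=
  hodgeConjectureFor_of_isHypersurfaceCutOutBy_of_odd (n := 3) hHD hX (by decide) hf h

/-! ### §5 Limits of one-legged fans -/

/-- **The limit of a fan with a unique leg is isomorphic to the vertex**: if `Fan.mk Y π` over an index
type with exactly one element is a limit cone, the leg `π default : Y ⟶ X` is an isomorphism (its
inverse is the lift of the identity fan). [cite: KashiwaraSchapira2006, §2.1–§2.2 (limits over a one-object category)] -/
theorem isIso_of_isLimit_fan_of_unique {C : Type*} [Category C] {J : Type*} [Unique J] {X Y : C}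
    (π : J → (Y ⟶ X)) (h : IsLimit (Fan.mk Y π)) : IsIso (π default) := by
  obtain ⟨l, hl⟩ : ∃ l : X ⟶ Y, l ≫ π default = 𝟙 X :=
    ⟨h.lift (Fan.mk X fun _ ↦ 𝟙 X), h.fac (Fan.mk X fun _ ↦ 𝟙 X) ⟨default⟩⟩
  refine ⟨l, ?_, hl⟩
  refine h.hom_ext fun j ↦ ?_
  obtain ⟨j⟩ := j
  obtain rfl : j = default := Subsingleton.elim _ _
  change (π default ≫ l) ≫ π default = 𝟙 Y ≫ π default
  rw [Category.assoc, hl, Category.comp_id, Category.id_comp]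

/-- With `J = Fin 1` (the K2 hypothesis `∃ π : Fin (k + 1) → (Y ⟶ X), Nonempty (IsLimit (Fan.mk Y π))`
at `k = 0`): the leg `π 0` is an isomorphism. [cite: KashiwaraSchapira2006, §2.1–§2.2] -/
theorem isIso_of_isLimit_fan_fin_one {C : Type*} [Category C] {X Y : C} (π : Fin 1 → (Y ⟶ X))
    (h : IsLimit (Fan.mk Y π)) : IsIso (π 0) :=
  isIso_of_isLimit_fan_of_unique π h

/-- With `J = Fin 1`: the limit vertex is isomorphic to `X`. [cite: KashiwaraSchapira2006, §2.1–§2.2] -/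
theorem nonempty_iso_of_isLimit_fan_fin_one {C : Type*} [Category C] {X Y : C} (π : Fin 1 → (Y ⟶ X))
    (h : IsLimit (Fan.mk Y π)) : Nonempty (Y ≅ X) :=
  haveI := isIso_of_isLimit_fan_fin_one π h
  ⟨asIso (π 0)⟩

/-- **The Hodge conjecture passes to the limit of a one-legged fan** (`Y ≅ X` by §5 and
`HodgeConjectureFor` is invariant under isomorphism — the tree's `nonempty_hodgeModel_iff_of_iso`,
`forall_hodgeClass_mem_algebraicClasses_iff_of_iso`). The case `k = 0` of crux K2.
[cite: SerreGAGA1956, §2] [cite: KashiwaraSchapira2006, §2.1–§2.2] -/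
theorem hodgeConjectureFor_of_isLimit_fan_fin_one {X Y : SchemeOver ℂ} (π : Fin 1 → (Y ⟶ X))
    (h : IsLimit (Fan.mk Y π)) (hX : HodgeConjectureFor n X) : HodgeConjectureFor n Y := by
  obtain ⟨e⟩ := nonempty_iso_of_isLimit_fan_fin_one π h
  exact ⟨(nonempty_hodgeModel_iff_of_iso e).2 hX.1,
    fun p ↦ (forall_hodgeClass_mem_algebraicClasses_iff_of_iso e p).2 (hX.2 p)⟩

/-- **K2 at `k = 0`, assembled**: for a smooth projective threefold `X` cut out by a form in `ℙ⁴` and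
any limit `Y` of a one-legged fan on `X`, the Hodge conjecture holds for `Y`.
[cite: VoisinHodgeII2003, §1.2.3 Cor. 1.24 and Cor. 1.25] [cite: SerreGAGA1956, §2] -/
theorem hodgeConjectureFor_threefold_of_isLimit_fan_fin_one (hHD : exists_isReal_hodgeModel)
    {X Y : SchemeOver ℂ} {f : MvPolynomial (Fin 5) ℂ} {d : ℕ} (hX : IsSmoothProjective 3 X)
    (hf : f.IsHomogeneous d) (hcut : IsHypersurfaceCutOutBy 4 f X) (π : Fin 1 → (Y ⟶ X))
    (h : IsLimit (Fan.mk Y π)) : HodgeConjectureFor 3 Y :=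
  hodgeConjectureFor_of_isLimit_fan_fin_one π h
    (hodgeConjectureFor_threefold_of_isHypersurfaceCutOutBy hHD hX hf hcut)

end HodgeConjecture

end Literature.AlgebraicGeometry.HodgeTheory

end
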